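import Literature.MathematicalPhysics.QuantumFieldTheory.Balaban1983to89.B6SectATreeGaugeDecompositionV1
import Literature.MathematicalPhysics.QuantumFieldTheory.Balaban1983to89.B6SectAPoincare211V1
import Literature.MathematicalPhysics.QuantumFieldTheory.Balaban1983to89.B6SectALemma24OneLevelV1
import Literature.MathematicalPhysics.QuantumFieldTheory.Balaban1983to89.B6GlobalChartV1

/-!
# `Balaban1983to89.B6SectADeltaACoerciveOneLevelV1` — T. Bałaban, *Propagators and renormalization transformations for lattice gauge theories. II*,
# Commun. Math. Phys. **96** (1984) 223–250 [Balaban1984PropagatorsII] p. 226 ∕ [Balaban1984PropagatorsI] Prop. 1.1 (1.90) p. 33 ON THE V1 TORUS CALCULUS: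
# ★★★ **«THE OPERATOR Δ_a IS BOUNDED FROM BELOW BY A POSITIVE CONSTANT», VOLUME-UNIFORMLY, FOR THE ONE-LEVEL FAMILY `Domains.whole k`** —
# the four stations of ROAD «C» assembled: `γ·‖A‖² ≤ ⟨A, Δ_aA⟩` for every `A`, with `γ = γ(d, L, k, c, w₀)` EXPLICIT and free of the volume

statement-level skeleton of published theorems with citation tags; proofs where landed; nothing here is a claim about the Yang–Mills mass gap

PDF held: `paper:balaban1984-cmp96-propagators-rt-ii` (journal page = PDF page + 222) pp. 224–226, 244–245; `paper:balaban1984-cmp95-propagators-rt-i` p. 33.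

CITATION HEADER (lean-in-tree rule).  Cell `pub-ymgap` (Track A, HUMAN RULING D-0062), node N10 [B13] lane owner `pub-ymgap-dag-n10-c` (g17), ROAD «C» station C5 (V1 half;
bus INBOX 2026-08-28T15:23Z), filed `--supports stmt-QuantumFields-27364` (count-neutral helper).  WHAT: the reduction C1 (`B6SectADeltaACoerciveReductionV1.
deltaAE_coercive_of_treeGauge_letters`) fed with its three letters, all PROVED for the one-level nested family `D = Domains.whole k` of r03∕p21's V1 model
(`Λ_k = T^{(k)}`, the small-field-everywhere member; [B6] p. 224 «we admit the case when some domains Ω_j are equal to T_η»): the axial-gauge decomposition C2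
(`B6SectATreeGaugeDecompositionV1.exists_treeGauge_decomposition_mem`, base points the block corners), the (2.11) letter C3 (`B6SectAPoincare211V1.poincare211_V1`, via
p03's `B6Eq211`), and the Lemma-2.4 letter C4 (`B6SectALemma24OneLevelV1.lemma24_letter_whole`, via pv09's `B6Lemma24Torus.lemma24_torus`).  Nothing restated; this file
is the composition plus the positivity of the constant.  For the multi-level `𝔅` (interfaces between levels) the Lemma-2.4 letter is print's Sect. C machinery and is
NOT claimed here; C1–C3 are already multi-level.

THE PRINT (verbatim).  [Balaban1984PropagatorsII] p. 226: *«One of our main results will be that the operator Δ_a is bounded from below by a positive constant»*;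
p. 239: *«otherwise the operator G_□ is simply equal to the operator G_j on the torus T_□. These operators were thoroughly investigated in paper [4], and their
properties described in Proposition 1.2»*; [Balaban1984PropagatorsI] p. 33, Prop. 1.1: *«Δ_a = G⁻¹ ≥ γ₀(Δ + I) (1.90) … with a positive constant γ₀ independent of
k, T_η»* (the tree holds (1.90) at p10's Fourier letters, `B5Prop11Lattice.ineq190_form`; THIS file is the same fact AT THE V1 LETTERS the N06∕N10 rows are typed at,
by the axial-gauge road of [B6] — constants ours).

WHAT IS PROVED (sorry-free; 0 `def`; standard axioms).
* `cornerV1_mem_iterBlock_of_lamSite` (C2's base-point hypothesis for the corners).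
* ★★★ `deltaAE_coercive_oneLevel`: for every ONE-LEVEL nested family `D` (`Ω_j = T_η` for `j ≤ k`; `Domains.whole k`, def-Y's `domT` at the top torus member), `d ≥ 2`,
  `c ≠ 0`, weights `w ≥ w₀ > 0` on `𝔅`: **`γ·‖A‖² ≤ ⟨A, Δ_aA⟩` for every bond configuration `A`, `Δ_a = deltaAE D c w`,** with
  `γ = (2∕κ + (4∕π)(1 + 4d·c²∕κ))⁻¹`, `κ = (1∕(12d²))·((Lᵏ)^{d+1})⁻¹·min(c², w₀∕(Lᵏ)^{d−2})`, `π = 8c²∕(Lᵏ)²`, `k = D.k` — no dependence on the volume `(m, K)`;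
  `deltaAE_coercive_const_pos` (`0 < γ`); ★★★ `deltaAE_coercive_whole` (`D = Domains.whole k` verbatim); ★★ `exists_deltaAE_coercive_oneLevel` (`∃ γ > 0, ∀ A,
  γ‖A‖² ≤ ⟨A, Δ_aA⟩`, the quantitative form of r03's `B6Eq231GaussianV1.exists_deltaAE_lower_bound` for these families, `γ` explicit and volume-free).
* §2 the W0 socket: `domT_oneLevel_of_lev_eq` (def-Y's `B6GlobalChartV1.domT` at a torus family of constant level `k` — e.g. `TDomains.top` — is one-level) and
  ★★★ `deltaAE_coercive_domT_of_lev_eq` (the same explicit coercivity for `deltaAE (domT hN D hk) c w` = def-Y's flat `Δ_a(1)` by `Node00.OpsYDeltaA.deltaAY_one`).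
HONEST SCOPE.  Composition of landed kernel theorems; ONE-LEVEL family only; constants ours (print: γ₀ of (1.90)); NOT a node discharge; count-neutral; nothing
continuum ∕ OS ∕ mass gap ∕ Clay.  The transfer to def-Y's `trIP` currency (`OpsYDeltaA.deltaAY … 1` on `M_N(ℂ)`-valued fields) and the LOCAL `Δ_{a,□}` edition are the
W0 half of C5 (n06-j ∕ the lane), not here.
-/

open scoped InnerProductSpace

namespace Literature.MathematicalPhysics.QuantumFieldTheory.Balaban1983to89.B6SectADeltaACoerciveOneLevelV1

open LatticeFieldCalculus B5Eq118OneStroke B6SectADomainsV1 B6SectAOperatorsV1 B6SectAVectorModelV1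
open BalabanImbrieJaffe1984to88.BIJ85AxialPropagator411 (BondSpace)
open B6SectADeltaACoerciveReductionV1 (deltaAE_coercive_of_treeGauge_letters)
open B6SectATreeGaugeDecompositionV1 (exists_treeGauge_decomposition_mem)
open B6SectAPoincare211V1 (poincare211_V1)
open B6SectALemma24OneLevelV1 (cornerV1 cornerV1_mem_iterBlock lemma24_letter_oneLevel lemma24_letter_const_pos whole_oneLevel)

noncomputable section

variable {P : Params} {k : ℕ}

/-- the block corners are admissible base points: `cornerV1 j y ∈ Bʲ(y)` for every `y ∈ Λ_j` of any nested family. [cite: Balaban1984PropagatorsI, (1.6)–(1.7) p.18] -/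
theorem cornerV1_mem_iterBlock_of_lamSite (D : Domains P) (j : ℕ) (y : Site P j) (hy : D.LamSite j y) : cornerV1 j y ∈ iterBlock j y :=
  cornerV1_mem_iterBlock ((D.le_of_lamSite hy).trans D.hk) y

/-- ★★★ **«Δ_a IS BOUNDED FROM BELOW BY A POSITIVE CONSTANT», ONE LEVEL, EXPLICIT AND VOLUME-FREE.**  For a one-level nested family `D` (`Ω_j = T_η` for `j ≤ k`),
`d ≥ 2`, `c ≠ 0`, weights `w ≥ w₀ > 0`: `γ·‖A‖² ≤ ⟨A, Δ_aA⟩` for every `A`, `Δ_a = deltaAE D c w`, with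
`γ = (2∕κ + (4∕π)(1 + 4d·c²∕κ))⁻¹`, `κ = (1∕(12d²))·((Lᵏ)^{d+1})⁻¹·min(c², w₀∕(Lᵏ)^{d−2})`, `π = 8c²∕(Lᵏ)²`, `k = D.k` — C1 fed with C2 (axial gauge at the corners), C3 ((2.11))
and C4 (Lemma 2.4 on the torus). [cite: Balaban1984PropagatorsII, (2.19) p.226, (2.11) p.225, Lemma 2.4 (2.128) p.245, (2.121) p.244; Balaban1984PropagatorsI, Prop. 1.1 (1.90) p.33] -/
theorem deltaAE_coercive_oneLevel (hd : 2 ≤ P.d) (D : Domains P) (hD : ∀ j, j ≤ D.k → D.Om j = Finset.univ) {c : ℝ} (hc : c ≠ 0)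
    {w : BondIdx D → ℝ} {w₀ : ℝ} (hw₀ : 0 < w₀) (hw : ∀ i, w₀ ≤ w i) (A : BondSpace P) :
    (2 / (1 / (12 * (P.d : ℝ) ^ 2) * (((P.L : ℝ) ^ D.k) ^ (P.d + 1))⁻¹ * min (c ^ 2) (w₀ / ((P.L : ℝ) ^ D.k) ^ (P.d - 2))) +
        4 / (8 * c ^ 2 / ((P.L : ℝ) ^ D.k) ^ 2) *
          (1 + 4 * P.d * c ^ 2 / (1 / (12 * (P.d : ℝ) ^ 2) * (((P.L : ℝ) ^ D.k) ^ (P.d + 1))⁻¹ * min (c ^ 2) (w₀ / ((P.L : ℝ) ^ D.k) ^ (P.d - 2)))))⁻¹ *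
      ‖A‖ ^ 2 ≤ ⟪A, deltaAE D c w A⟫_ℝ := by
  have hd1 : 1 ≤ P.d := le_trans (by norm_num) hd
  have hκ := lemma24_letter_const_pos (P := P) D.k hc hw₀ hd1
  have hπ : 0 < 8 * c ^ 2 / ((P.L : ℝ) ^ D.k) ^ 2 := by
    have hL : (0 : ℝ) < (P.L : ℝ) ^ D.k := pow_pos (by exact_mod_cast P.L_pos) _
    positivity
  refine deltaAE_coercive_of_treeGauge_letters D c (fun i => hw₀.le.trans (hw i))
    {B : BondSpace P | ∀ (j : ℕ) (y : Site P j), D.LamSite j y → ∀ x ∈ iterBlock j y, stairSum (WithLp.ofLp B) (cornerV1 j y) x = 0}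
    hκ hπ (fun B hB => lemma24_letter_oneLevel hd D hD c hw₀.le hw B hB) (fun n hn => poincare211_V1 D c hn)
    (fun A' => exists_treeGauge_decomposition_mem D hc (fun j y => cornerV1 j y) (cornerV1_mem_iterBlock_of_lamSite D) A') A

/-- the constant is positive. [cite: Balaban1984PropagatorsII, (2.19) p.226; folklore] -/
theorem deltaAE_coercive_const_pos (hd : 2 ≤ P.d) (k : ℕ) {c w₀ : ℝ} (hc : c ≠ 0) (hw₀ : 0 < w₀) :
    0 < (2 / (1 / (12 * (P.d : ℝ) ^ 2) * (((P.L : ℝ) ^ k) ^ (P.d + 1))⁻¹ * min (c ^ 2) (w₀ / ((P.L : ℝ) ^ k) ^ (P.d - 2))) +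
        4 / (8 * c ^ 2 / ((P.L : ℝ) ^ k) ^ 2) *
          (1 + 4 * P.d * c ^ 2 / (1 / (12 * (P.d : ℝ) ^ 2) * (((P.L : ℝ) ^ k) ^ (P.d + 1))⁻¹ * min (c ^ 2) (w₀ / ((P.L : ℝ) ^ k) ^ (P.d - 2)))))⁻¹ := by
  have hd1 : 1 ≤ P.d := le_trans (by norm_num) hd
  have hκ := lemma24_letter_const_pos (P := P) k hc hw₀ hd1
  have hL : (0 : ℝ) < (P.L : ℝ) ^ k := pow_pos (by exact_mod_cast P.L_pos) _
  have hπ : 0 < 8 * c ^ 2 / ((P.L : ℝ) ^ k) ^ 2 := by positivity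
  positivity

/-- ★★★ **the one-level family `Domains.whole k` verbatim.** [cite: Balaban1984PropagatorsII, (2.19) p.226, (2.1) p.224; Balaban1984PropagatorsI, Prop. 1.1 (1.90) p.33] -/
theorem deltaAE_coercive_whole (hd : 2 ≤ P.d) (hk : k ≤ P.m + P.K) {c : ℝ} (hc : c ≠ 0) {w : BondIdx (Domains.whole k hk) → ℝ} {w₀ : ℝ}
    (hw₀ : 0 < w₀) (hw : ∀ i, w₀ ≤ w i) (A : BondSpace P) :
    (2 / (1 / (12 * (P.d : ℝ) ^ 2) * (((P.L : ℝ) ^ k) ^ (P.d + 1))⁻¹ * min (c ^ 2) (w₀ / ((P.L : ℝ) ^ k) ^ (P.d - 2))) +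
        4 / (8 * c ^ 2 / ((P.L : ℝ) ^ k) ^ 2) *
          (1 + 4 * P.d * c ^ 2 / (1 / (12 * (P.d : ℝ) ^ 2) * (((P.L : ℝ) ^ k) ^ (P.d + 1))⁻¹ * min (c ^ 2) (w₀ / ((P.L : ℝ) ^ k) ^ (P.d - 2)))))⁻¹ *
      ‖A‖ ^ 2 ≤ ⟪A, deltaAE (Domains.whole k hk) c w A⟫_ℝ :=
  deltaAE_coercive_oneLevel hd (Domains.whole k hk) (whole_oneLevel hk) hc hw₀ hw A

/-- ★★ **the quantitative `∃ γ > 0`** for every one-level nested family (r03's `B6Eq231GaussianV1.exists_deltaAE_lower_bound` with `γ` EXPLICIT in `(d, L, k, c, w₀)` and free of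
the volume `(m, K)`). [cite: Balaban1984PropagatorsII, (2.19) p.226; Balaban1984PropagatorsI, Prop. 1.1 (1.90) p.33] -/
theorem exists_deltaAE_coercive_oneLevel (hd : 2 ≤ P.d) (D : Domains P) (hD : ∀ j, j ≤ D.k → D.Om j = Finset.univ) {c : ℝ} (hc : c ≠ 0)
    {w : BondIdx D → ℝ} {w₀ : ℝ} (hw₀ : 0 < w₀) (hw : ∀ i, w₀ ≤ w i) :
    ∃ γ : ℝ, 0 < γ ∧
      γ = (2 / (1 / (12 * (P.d : ℝ) ^ 2) * (((P.L : ℝ) ^ D.k) ^ (P.d + 1))⁻¹ * min (c ^ 2) (w₀ / ((P.L : ℝ) ^ D.k) ^ (P.d - 2))) +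
        4 / (8 * c ^ 2 / ((P.L : ℝ) ^ D.k) ^ 2) *
          (1 + 4 * P.d * c ^ 2 / (1 / (12 * (P.d : ℝ) ^ 2) * (((P.L : ℝ) ^ D.k) ^ (P.d + 1))⁻¹ * min (c ^ 2) (w₀ / ((P.L : ℝ) ^ D.k) ^ (P.d - 2)))))⁻¹ ∧
      ∀ A : BondSpace P, γ * ‖A‖ ^ 2 ≤ ⟪A, deltaAE D c w A⟫_ℝ :=
  ⟨_, deltaAE_coercive_const_pos hd D.k hc hw₀, rfl, deltaAE_coercive_oneLevel hd D hD hc hw₀ hw⟩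

/-! ## §2. The W0 socket: def-Y's torus members with constant level `k` (`TDomains.top`) are one-level — `deltaAE (domT …) ≥ γ` -/

section DefY

open B6GlobalChartV1 (PV domT)
open B6MultiLevelBoxOperator (N0)
open B6MultiLevelTorusOperator (TDomains)

variable {d ℓ : ℕ} {m K : ℕ} {hd : 1 ≤ d + 1} {hL : Odd (ℓ + 1) ∧ 1 < ℓ + 1}

/-- **def-Y's V1 domain datum is one-level when the torus family has constant level `k`** (e.g. `TDomains.top`, «Ω_j = T_η for j = 1, 2, …»): `(domT hN D hk).Om j = T^{(j)}`
for every `j ≤ k`. [cite: Balaban1984PropagatorsII, (2.1) p.224] -/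
theorem domT_oneLevel_of_lev_eq {Mh k R : ℕ} {P' : Fin (d + 1) → ℕ} (hN : ∀ μ, N0 ℓ Mh k P' μ = (PV d ℓ m K hd hL).sitesPerDir 0)
    (D : TDomains d ℓ Mh k P' R) (hk : k ≤ m + K) (hlev : ∀ x, D.lev x = k) :
    ∀ j, j ≤ (domT hN D hk).k → (domT hN D hk).Om j = Finset.univ := by
  classical
  intro j hj
  have hjk : j ≤ k := hj
  by_cases hj0 : j = 0
  · subst hj0
    exact (domT hN D hk).Om_zero
  · show (if j = 0 then Finset.univ else if j ≤ k then
        Finset.univ.filter (fun y : Site (PV d ℓ m K hd hL) j =>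
          ∀ x : Site (PV d ℓ m K hd hL) 0, B5Eq118OneStroke.iterBlockOf j x = y → j ≤ D.lev (B6GlobalChartV1.toBox hN x))
      else ∅) = Finset.univ
    rw [if_neg hj0, if_pos hjk]
    refine Finset.filter_true_of_mem fun y _ x _ => ?_
    rw [hlev]; exact hjk

/-- ★★★ **«Δ_a IS BOUNDED FROM BELOW BY A POSITIVE CONSTANT» FOR def-Y's TOP TORUS MEMBERS** — the W0 socket: for a torus family `D` with constant level `k` (`d + 1 ≥ 2`,
`c ≠ 0`, weights `w ≥ w₀ > 0`), `γ·‖A‖² ≤ ⟨A, deltaAE (domT hN D hk) c w A⟩` for every `A` with the explicit volume-free `γ` of `deltaAE_coercive_oneLevel`; by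
`Node00.OpsYDeltaA.deltaAY_one` this is the flat operator `Δ_a(1)` of NODE 00's letters (the transfer to the `trIP` currency is the N06 lane's).
[cite: Balaban1984PropagatorsII, (2.19) p.226, (2.1) p.224; Balaban1984PropagatorsI, Prop. 1.1 (1.90) p.33] -/
theorem deltaAE_coercive_domT_of_lev_eq (hd2 : 2 ≤ d + 1) {Mh k R : ℕ} {P' : Fin (d + 1) → ℕ}
    (hN : ∀ μ, N0 ℓ Mh k P' μ = (PV d ℓ m K hd hL).sitesPerDir 0) (D : TDomains d ℓ Mh k P' R) (hk : k ≤ m + K) (hlev : ∀ x, D.lev x = k)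
    {c : ℝ} (hc : c ≠ 0) {w : BondIdx (domT hN D hk) → ℝ} {w₀ : ℝ} (hw₀ : 0 < w₀) (hw : ∀ i, w₀ ≤ w i) (A : BondSpace (PV d ℓ m K hd hL)) :
    (2 / (1 / (12 * (((PV d ℓ m K hd hL).d : ℕ) : ℝ) ^ 2) * ((((PV d ℓ m K hd hL).L : ℝ) ^ k) ^ ((PV d ℓ m K hd hL).d + 1))⁻¹ *
          min (c ^ 2) (w₀ / (((PV d ℓ m K hd hL).L : ℝ) ^ k) ^ ((PV d ℓ m K hd hL).d - 2))) +
        4 / (8 * c ^ 2 / (((PV d ℓ m K hd hL).L : ℝ) ^ k) ^ 2) *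
          (1 + 4 * (PV d ℓ m K hd hL).d * c ^ 2 / (1 / (12 * (((PV d ℓ m K hd hL).d : ℕ) : ℝ) ^ 2) *
            ((((PV d ℓ m K hd hL).L : ℝ) ^ k) ^ ((PV d ℓ m K hd hL).d + 1))⁻¹ * min (c ^ 2) (w₀ / (((PV d ℓ m K hd hL).L : ℝ) ^ k) ^ ((PV d ℓ m K hd hL).d - 2)))))⁻¹ *
      ‖A‖ ^ 2 ≤ ⟪A, deltaAE (domT hN D hk) c w A⟫_ℝ :=
  deltaAE_coercive_oneLevel (P := PV d ℓ m K hd hL) hd2 (domT hN D hk) (domT_oneLevel_of_lev_eq hN D hk hlev) hc hw₀ hw A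

end DefY

end

end Literature.MathematicalPhysics.QuantumFieldTheory.Balaban1983to89.B6SectADeltaACoerciveOneLevelV1
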